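import Summits.CriticalPhenomena.SAWScalingLimit.Theorems.SAWTotalPositivityCriticalBubbleBoundJoinDefs

/-!
# Objects of the JOIN-MASS programme, II: Madras' joining surgery
(crux `SAWTotalPositivity.CriticalBubbleBound`, stmt-CriticalPhenomena-7117; line `docking-census-joining`,
lead prover c6; companion of `…JoinDefs.lean`)

Definitions only (no statement of the programme is asserted here) of the CONSTRUCTIVE side of the
join-mass ledger: the Madras join of two lex-rooted polygon classes at a vertical offset `k`
(Madras 1995 as recalled in Hammond, Ann. Probab. 46 (2018) §4.1, re-designed explicitly — the
thirteen-case figure of the source is replaced by EIGHT cases, each "replace a one- or two-edge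
sub-path by an explicit nine- or ten-edge path through provably free cells", net `+8` edges):

* `evx`, `vxs`, `IsV` — vertices of edge sets; `trE` (translation), `rotY`/`rotE` (rotation by `π`
  about a site), `flipV` (the joining plaquette flip: remove the two vertical sides, add the two
  horizontal ones — inverse of `flipH`);
* `contactDiffs`, `contactT` — the FIRST-CONTACT horizontal translate of the partner (slide it in
  from `+∞`; contact = a pair of vertices in the same column at vertical distance `≤ 2`);
* `cands`, `centres`, `winY` — the WINDOW: the lexicographically largest (row first) site `Y` whose
  vertical 3-window `{Y-e₁, Y, Y+e₁}` contains a vertex of each polygon;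
* `JCase`, `caseOf`, `pathPts`, `remPairs`, `pt`, `addedE`, `removedE`, `outOff`, `modify`,
  `unmodify` — the eight local cases at the window, the explicit added paths / removed edges
  (coordinates relative to `Y`), the column offset (`2` or `3`) of the output vertical 2-segment,
  the modified polygon and its explicit inverse given the case tag;
* `modifyR`, `caseR` (the partner is treated through the rotation by `π` about `Y`), `spacer`
  (`T₂ ∈ {5,6,7}`), `jCorner` (lower-left corner `(Y₁ + outOff, Y₂)` of the junction plaquette),
  `joinAt` (the Madras join polygon `J = flipV (τ̃ ∪ (σ̃ + T₂ e₀))`);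
* `sigmaShift`, `joinY`, `joinPoly`, `joinCorner`, `joinTags` — the whole arrow
  `(χ¹, χ², k) ↦ (J, junction, tags)` for `χ¹ ∈ lexRooted j`, `χ² ∈ lexRooted m`;
* `lexMinV`, `rerootWalk`, `rerootCorner` — re-rooting a positioned polygon at its
  lowest-then-leftmost vertex (back into the class model `lexRooted`);
* `offsets` (the admissible vertical offsets `k ∈ [max 3 (tipRow χ¹ - ymax χ²), tipRow χ¹]`,
  Hammond Lemma 4.11) and `Dent i` — the ENTROPY-side mass `D_i` of the ledger.

Sources: N. Madras, J. Statist. Phys. 78 (1995) 681–699 (procedure, via Hammond); A. Hammond,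
Ann. Probab. 46 (2018) = arXiv:1808.09032, §4.1 (Def. 4.3), §4.3 (Def. 4.8, Lemma 4.11).
-/

noncomputable section

open Literature.Probability.LatticeModels
open Literature.Probability.RandomPlanarGeometry Literature.Probability.RandomPlanarGeometry.SAW
open scoped BigOperators
open Summit.CriticalPhenomena.SAWScalingLimit.Theorems.CriticalBubbleBound.Negative (e₀)
open Summit.CriticalPhenomena.SAWScalingLimit.Theorems.CriticalBubbleBound.Docking

namespace Summit.CriticalPhenomena.SAWScalingLimit.Theorems.CriticalBubbleBound.Join

/-! ## Vertices of edge sets; translations, rotations, the joining flip -/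

/-- The two endpoints of an edge, as a `Finset`. [folklore] -/
def evx (e : Sym2 (Site 2)) : Finset (Site 2) :=
  Sym2.lift ⟨fun a b => ({a, b} : Finset (Site 2)), fun a b => Finset.pair_comm a b⟩ e

/-- The vertex set of a finite edge set. [folklore] -/
def vxs (E : Finset (Sym2 (Site 2))) : Finset (Site 2) := E.biUnion evx

/-- `p` is a vertex of (an edge of) `E`. [folklore] -/
def IsV (E : Finset (Sym2 (Site 2))) (p : Site 2) : Prop := ∃ e ∈ E, p ∈ e

/-- `IsV E p` is decidable. [folklore] -/
instance (E : Finset (Sym2 (Site 2))) (p : Site 2) : Decidable (IsV E p) := by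
  unfold IsV; infer_instance

/-- Translation of an edge set by `v`. [folklore] -/
def trE (v : Site 2) (E : Finset (Sym2 (Site 2))) : Finset (Sym2 (Site 2)) :=
  E.image (Sym2.map fun p => p + v)

/-- Rotation by `π` about the site `Y`: `p ↦ 2Y - p`. [cite: Hammond2015SAPJoining, §4.1 (σ'' = σ' rotated about Y)] -/
def rotY (Y p : Site 2) : Site 2 := Y + Y - p

/-- Rotation by `π` about `Y` of an edge set. [cite: Hammond2015SAPJoining, §4.1] -/
def rotE (Y : Site 2) (E : Finset (Sym2 (Site 2))) : Finset (Sym2 (Site 2)) :=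
  E.image (Sym2.map (rotY Y))

/-- The JOINING flip at the plaquette with lower-left corner `q`: remove its two vertical sides,
add its two horizontal ones (inverse of the un-joining flip `flipH`). [cite: Hammond2015SAPJoining, Definition 2.3] -/
def flipV (E : Finset (Sym2 (Site 2))) (q : Site 2) : Finset (Sym2 (Site 2)) :=
  insert s(q, q + e₀) (insert s(q + e₁, q + e₀ + e₁) ((E.erase s(q, q + e₁)).erase s(q + e₀, q + e₀ + e₁)))

/-! ## First contact and the window -/

open Classical in
/-- The horizontal translates `T` at which the partner (vertex set `B`, to be moved by `T e₀`)
is IN CONTACT with the vertex set `A`: some `a ∈ A`, `b ∈ B` end up in the same column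
(`a 0 = b 0 + T`) at vertical distance `≤ 2`. [cite: Hammond2015SAPJoining, §4.1 (Madras' procedure)] -/
def contactDiffs (A B : Finset (Site 2)) : Finset ℤ :=
  ((A ×ˢ B).filter fun p => |p.1 1 - p.2 1| ≤ 2).image fun p => p.1 0 - p.2 0

/-- The FIRST-CONTACT translate `T*`: sliding the partner in from `+∞`, the largest contact
translate (`0` if the two vertex sets never come into contact). [cite: Hammond2015SAPJoining, §4.1] -/
def contactT (A B : Finset (Site 2)) : ℤ :=
  if h : (contactDiffs A B).Nonempty then (contactDiffs A B).max' h else 0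

/-- The sites whose vertical 3-window `{z - e₁, z, z + e₁}` meets the vertex set `V`. [folklore] -/
def cands (V : Finset (Site 2)) : Finset (Site 2) := V.biUnion fun a => {a - e₁, a, a + e₁}

/-- Window centres: sites whose vertical 3-window meets both vertex sets. [cite: Hammond2015SAPJoining, §4.1 (the vertex z)] -/
def centres (A B : Finset (Site 2)) : Finset (Site 2) := cands A ∩ cands B

/-- A nonempty finite set of sites has a lexicographically LARGEST element (row first, then
column). [folklore] -/
theorem exists_lexMax {S : Finset (Site 2)} (h : S.Nonempty) :
    ∃ z ∈ S, ∀ w ∈ S, w 1 < z 1 ∨ (w 1 = z 1 ∧ w 0 ≤ z 0) := by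
  classical
  obtain ⟨t, ht, htmax⟩ := S.exists_max_image (fun x => x 1) h
  obtain ⟨z, hz, hzmax⟩ := (S.filter fun x => x 1 = t 1).exists_max_image (fun x => x 0)
    ⟨t, Finset.mem_filter.2 ⟨ht, rfl⟩⟩
  rw [Finset.mem_filter] at hz
  refine ⟨z, hz.1, fun w hw => ?_⟩
  rcases lt_or_eq_of_le (hz.2 ▸ htmax w hw) with hlt | heq
  · exact Or.inl hlt
  · exact Or.inr ⟨heq, hzmax w (Finset.mem_filter.2 ⟨hw, heq.trans hz.2⟩)⟩

/-- A nonempty finite set of sites has a lexicographically SMALLEST element (row first, then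
column): the lowest-then-leftmost site. [folklore] -/
theorem exists_lexMin {S : Finset (Site 2)} (h : S.Nonempty) :
    ∃ z ∈ S, ∀ w ∈ S, z 1 < w 1 ∨ (z 1 = w 1 ∧ z 0 ≤ w 0) := by
  classical
  obtain ⟨t, ht, htmin⟩ := S.exists_min_image (fun x => x 1) h
  obtain ⟨z, hz, hzmin⟩ := (S.filter fun x => x 1 = t 1).exists_min_image (fun x => x 0)
    ⟨t, Finset.mem_filter.2 ⟨ht, rfl⟩⟩
  rw [Finset.mem_filter] at hz
  refine ⟨z, hz.1, fun w hw => ?_⟩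
  rcases lt_or_eq_of_le (hz.2 ▸ htmin w hw) with hlt | heq
  · exact Or.inl hlt
  · exact Or.inr ⟨heq, hzmin w (Finset.mem_filter.2 ⟨hw, heq.symm.trans hz.2⟩)⟩

open Classical in
/-- THE WINDOW `Y`: the lexicographically largest window centre (`0` if there is none).
[cite: Hammond2015SAPJoining, §4.1 (the vertex Y)] -/
def winY (A B : Finset (Site 2)) : Site 2 :=
  if h : (centres A B).Nonempty then Classical.choose (exists_lexMax h) else 0

open Classical in
/-- The LOWEST-THEN-LEFTMOST site of a finite set (`0` if empty). [folklore] -/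
def lexMinV (S : Finset (Site 2)) : Site 2 :=
  if h : S.Nonempty then Classical.choose (exists_lexMin h) else 0

/-! ## The eight local cases and the modification -/

/-- The eight local cases of the modification at the window `Y` of a polygon `E` whose right
corridor `{x > Y 0} × {Y 1 - 1, Y 1, Y 1 + 1}` is vertex-free: `Aup`/`Adown` — `Y` is a vertex
(bump its upper, resp. lower, vertical edge); `B1`/`B2a`/`B2b` — `Y` is not a vertex but `Y + e₁`
is (a corner opening up-left), sub-cases by the cell `Y + e₀ + 2e₁`; `C1`/`C2a`/`C2b` — neither
`Y` nor `Y + e₁` is a vertex but `Y - e₁` is (mirror images of the `B` cases).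
[cite: Hammond2015SAPJoining, §4.1 (Figure: Madras' cases)] -/
inductive JCase
  | Aup | Adown | B1 | B2a | B2b | C1 | C2a | C2b
  deriving DecidableEq

/-- The site `Y + (a, b)`. [folklore] -/
def pt (Y : Site 2) (d : ℤ × ℤ) : Site 2 := Y + ![d.1, d.2]

open Classical in
/-- The case of the edge set `E` at the window `Y` (nested membership tests; see `JCase`).
[cite: Hammond2015SAPJoining, §4.1] -/
def caseOf (E : Finset (Sym2 (Site 2))) (Y : Site 2) : JCase :=
  if IsV E Y then (if s(Y, Y + e₁) ∈ E then .Aup else .Adown)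
  else if IsV E (Y + e₁) then
    (if IsV E (pt Y (1, 2)) then (if s(pt Y (1, 2), pt Y (2, 2)) ∈ E then .B2a else .B2b) else .B1)
  else
    (if IsV E (pt Y (1, -2)) then (if s(pt Y (1, -2), pt Y (2, -2)) ∈ E then .C2a else .C2b) else .C1)

/-- The ADDED path of each case, as the list of its sites relative to `Y` (nine or ten edges; the
first and last sites are vertices of `E`, the interior ones are fresh). [cite: Hammond2015SAPJoining, §4.1] -/
def pathPts : JCase → List (ℤ × ℤ)
  | .Aup => [(0, 0), (1, 0), (1, -1), (2, -1), (3, -1), (3, 0), (3, 1), (2, 1), (1, 1), (0, 1)]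
  | .Adown => [(0, 0), (1, 0), (1, 1), (2, 1), (3, 1), (3, 0), (3, -1), (2, -1), (1, -1), (0, -1)]
  | .B1 => [(0, 1), (0, 0), (1, 0), (1, -1), (2, -1), (2, 0), (2, 1), (1, 1), (1, 2), (0, 2)]
  | .B2a => [(1, 2), (1, 1), (1, 0), (1, -1), (2, -1), (3, -1), (3, 0), (3, 1), (2, 1), (2, 2)]
  | .B2b => [(0, 1), (0, 0), (1, 0), (1, -1), (2, -1), (3, -1), (3, 0), (3, 1), (2, 1), (1, 1), (1, 2)]
  | .C1 => [(0, -1), (0, 0), (1, 0), (1, 1), (2, 1), (2, 0), (2, -1), (1, -1), (1, -2), (0, -2)]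
  | .C2a => [(1, -2), (1, -1), (1, 0), (1, 1), (2, 1), (3, 1), (3, 0), (3, -1), (2, -1), (2, -2)]
  | .C2b => [(0, -1), (0, 0), (1, 0), (1, 1), (2, 1), (3, 1), (3, 0), (3, -1), (2, -1), (1, -1), (1, -2)]

/-- The REMOVED edges of each case (one or two), as pairs of sites relative to `Y`.
[cite: Hammond2015SAPJoining, §4.1] -/
def remPairs : JCase → List ((ℤ × ℤ) × (ℤ × ℤ))
  | .Aup => [((0, 0), (0, 1))]
  | .Adown => [((0, -1), (0, 0))]
  | .B1 => [((0, 1), (0, 2))]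
  | .B2a => [((1, 2), (2, 2))]
  | .B2b => [((0, 1), (0, 2)), ((0, 2), (1, 2))]
  | .C1 => [((0, -2), (0, -1))]
  | .C2a => [((1, -2), (2, -2))]
  | .C2b => [((0, -2), (0, -1)), ((0, -2), (1, -2))]

/-- Column offset (from `Y 0`) of the output vertical 2-segment: `2` in cases `B1`, `C1`, else `3`
("`τ̃` extends `τ` to the right of `Y` by two or three units"). [cite: Hammond2015SAPJoining, §4.1] -/
def outOff : JCase → ℤ
  | .B1 => 2
  | .C1 => 2
  | _ => 3

/-- The added edges of case `c` at `Y`. [cite: Hammond2015SAPJoining, §4.1] -/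
def addedE (c : JCase) (Y : Site 2) : Finset (Sym2 (Site 2)) :=
  (((pathPts c).zip (pathPts c).tail).map fun p => s(pt Y p.1, pt Y p.2)).toFinset

/-- The removed edges of case `c` at `Y`. [cite: Hammond2015SAPJoining, §4.1] -/
def removedE (c : JCase) (Y : Site 2) : Finset (Sym2 (Site 2)) :=
  ((remPairs c).map fun p => s(pt Y p.1, pt Y p.2)).toFinset

/-- The interior (fresh) sites of the added path of case `c` at `Y`. [folklore] -/
def newCells (c : JCase) (Y : Site 2) : Finset (Site 2) :=
  (((pathPts c).tail.dropLast).map (pt Y)).toFinset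

/-- MADRAS' MODIFICATION `τ̃` of the edge set `E` at the window `Y`: remove the case's edges, add
the case's path; `#τ̃ = #E + 8`, and `τ̃` carries the vertical 2-segment in column `Y 0 + outOff`
across the three window rows. [cite: Hammond2015SAPJoining, §4.1 (modify τ)] -/
def modify (E : Finset (Sym2 (Site 2))) (Y : Site 2) : Finset (Sym2 (Site 2)) :=
  (E \ removedE (caseOf E Y) Y) ∪ addedE (caseOf E Y) Y

/-- The explicit inverse of the modification GIVEN the case tag: remove the added path, put the
removed edges back. [folklore] -/
def unmodify (c : JCase) (E : Finset (Sym2 (Site 2))) (Y : Site 2) : Finset (Sym2 (Site 2)) :=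
  (E \ addedE c Y) ∪ removedE c Y

/-- The partner's modification `σ̃`: rotate by `π` about `Y`, modify, rotate back ("form the
modification of `σ''` according to the same rules, then rotate back"). [cite: Hammond2015SAPJoining, §4.1 (modify σ)] -/
def modifyR (E : Finset (Sym2 (Site 2))) (Y : Site 2) : Finset (Sym2 (Site 2)) :=
  rotE Y (modify (rotE Y E) Y)

/-- The partner's case (the case of its rotation about `Y`). [cite: Hammond2015SAPJoining, §4.1] -/
def caseR (E : Finset (Sym2 (Site 2))) (Y : Site 2) : JCase := caseOf (rotE Y E) Y

/-- The spacer `T₂ = outOff(τ) + outOff(σ) + 1 ∈ {5, 6, 7}`: after translating `σ̃` by `T₂ e₀`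
its vertical 2-segment (column `Y 0 - outOff σ`) faces that of `τ̃` (column `Y 0 + outOff τ`)
across one plaquette width. [cite: Hammond2015SAPJoining, §4.1 (T₂ ∈ {5,6,7})] -/
def spacer (cτ cσ : JCase) : ℤ := outOff cτ + outOff cσ + 1

/-- Lower-left corner `(Y 0 + outOff τ, Y 1)` of the JUNCTION plaquette `P¹` (the upper of the
two facing plaquettes). [cite: Hammond2015SAPJoining, Definition 4.3 (junction plaquette)] -/
def jCorner (cτ : JCase) (Y : Site 2) : Site 2 := pt Y (outOff cτ, 0)

/-- The Madras JOIN of the positioned polygons `τ` and `σ'` (already at first contact) with window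
`Y`: `J = flipV (τ̃ ∪ (σ̃ + T₂ e₀))` at the junction corner. [cite: Hammond2015SAPJoining, Definition 4.3] -/
def joinAt (τ σ' : Finset (Sym2 (Site 2))) (Y : Site 2) : Finset (Sym2 (Site 2)) :=
  flipV (modify τ Y ∪ trE ![spacer (caseOf τ Y) (caseR σ' Y), 0] (modifyR σ' Y))
    (jCorner (caseOf τ Y) Y)

/-! ## The arrow `(χ¹, χ², k) ↦ (J, junction, tags)` on the class model -/

/-- The partner's position at first contact: `χ²` translated by `(T*, k)`, `T*` the first-contact
translate of `P(χ²) + k e₁` against `P(χ¹)`. [cite: Hammond2015SAPJoining, §4.1 (σ' = σ + T₁ e₁)] -/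
def sigmaShift (j m : ℕ) (χ₁ χ₂ : ℕ → Site 2) (k : ℤ) : Site 2 :=
  ![contactT (verts j χ₁) ((verts m χ₂).image fun p => p + ![0, k]), k]

/-- The window of the arrow `(χ¹, χ², k)`. [cite: Hammond2015SAPJoining, §4.1] -/
def joinY (j m : ℕ) (χ₁ χ₂ : ℕ → Site 2) (k : ℤ) : Site 2 :=
  winY (verts j χ₁) (verts m (shift (sigmaShift j m χ₁ χ₂ k) χ₂))

/-- The join polygon of the arrow `(χ¹, χ², k)` (a positioned `(j + m + 18)`-edge polygon).
[cite: Hammond2015SAPJoining, Definition 4.3] -/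
def joinPoly (j m : ℕ) (χ₁ χ₂ : ℕ → Site 2) (k : ℤ) : Finset (Sym2 (Site 2)) :=
  joinAt (pedges j χ₁) (pedges m (shift (sigmaShift j m χ₁ χ₂ k) χ₂)) (joinY j m χ₁ χ₂ k)

/-- The junction corner of the arrow `(χ¹, χ², k)` (positioned). [cite: Hammond2015SAPJoining, Definition 4.3] -/
def joinCorner (j m : ℕ) (χ₁ χ₂ : ℕ → Site 2) (k : ℤ) : Site 2 :=
  jCorner (caseOf (pedges j χ₁) (joinY j m χ₁ χ₂ k)) (joinY j m χ₁ χ₂ k)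

/-- The two case tags of the arrow `(χ¹, χ², k)`. [folklore] -/
def joinTags (j m : ℕ) (χ₁ χ₂ : ℕ → Site 2) (k : ℤ) : JCase × JCase :=
  (caseOf (pedges j χ₁) (joinY j m χ₁ χ₂ k),
    caseR (pedges m (shift (sigmaShift j m χ₁ χ₂ k) χ₂)) (joinY j m χ₁ χ₂ k))

/-! ## Re-rooting a positioned polygon into the class model -/

open Classical in
/-- The lex-rooted walk of walk length `n` whose rooted polygon is the translate of `E` taking the
lowest-then-leftmost vertex of `E` to the origin (`0` if there is none, e.g. if `E` is not a
polygon with `n + 1` edges). [cite: MadrasSlade1993, Definition 3.2.2] -/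
def rerootWalk (E : Finset (Sym2 (Site 2))) (n : ℕ) : ℕ → Site 2 :=
  if h : ∃ χ : ℕ → Site 2, χ ∈ lexRooted n ∧ pedges n χ = trE (-lexMinV (vxs E)) E
  then Classical.choose h else 0

/-- A positioned site read in the re-rooted frame of `E`. [folklore] -/
def rerootSite (E : Finset (Sym2 (Site 2))) (q : Site 2) : Site 2 := q - lexMinV (vxs E)

/-! ## Admissible offsets and the entropy-side mass -/

/-- The ADMISSIBLE vertical offsets of the partner class `χ²` against `χ¹`: `k ≥ 3` (the partner
stays strictly above the root row, even after surgery) and the partner, raised by `k`, has a vertex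
on the row of the highest rightmost vertex of `P(χ¹)` (`tipRow - ymax χ² ≤ k ≤ tipRow`), which forces
all rightmost vertices of the join onto the partner's side. [cite: Hammond2015SAPJoining, Lemma 4.11] -/
def offsets (j m : ℕ) (χ₁ χ₂ : ℕ → Site 2) : Finset ℤ :=
  Finset.Icc (max 3 (tipRow j χ₁ - ymax m χ₂)) (tipRow j χ₁)

/-- ENTROPY-side mass of the ledger at scale `i`: over pairs of classes of shifted indices
`n, n' ∈ B_i` (walk lengths `n - 17`, `n' - 17`), the number of admissible offsets times the pair
weight `x_c^{(n-16)+(n'-16)}`. [cite: Hammond2015SAPJoining, Lemma 4.12 (arrow count)] -/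
def Dent (i : ℕ) : ℝ :=
  ∑ n ∈ block i, ∑ n' ∈ block i,
    if joinShift ≤ n ∧ joinShift ≤ n' then
      ∑ χ₁ ∈ lexRooted (n - joinShift), ∑ χ₂ ∈ lexRooted (n' - joinShift),
        ((offsets (n - joinShift) (n' - joinShift) χ₁ χ₂).card : ℝ) *
          criticalFugacity ^ (n - joinShift + 1 + (n' - joinShift + 1))
    else 0

/-! ## Elementary API -/

/-- Membership in `evx`. [folklore] -/
theorem mem_evx {e : Sym2 (Site 2)} {p : Site 2} : p ∈ evx e ↔ p ∈ e := by
  induction e using Sym2.ind with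
  | _ a b => simp [evx, Sym2.lift_mk]

/-- Membership in `vxs`: the vertices of `E` are the sites on its edges. [folklore] -/
theorem mem_vxs {E : Finset (Sym2 (Site 2))} {p : Site 2} : p ∈ vxs E ↔ IsV E p := by
  simp only [vxs, Finset.mem_biUnion, mem_evx, IsV]

/-- Membership in a translate. [folklore] -/
theorem mem_trE {v : Site 2} {E : Finset (Sym2 (Site 2))} {e : Sym2 (Site 2)} :
    e ∈ trE v E ↔ ∃ e' ∈ E, Sym2.map (fun p => p + v) e' = e := by
  simp only [trE, Finset.mem_image]

/-- `rotY Y` is an involution. [folklore] -/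
theorem rotY_rotY (Y p : Site 2) : rotY Y (rotY Y p) = p := by
  simp only [rotY]; abel

/-- The window is a window centre whenever one exists. [folklore] -/
theorem winY_spec {A B : Finset (Site 2)} (h : (centres A B).Nonempty) :
    winY A B ∈ centres A B ∧
      ∀ w ∈ centres A B, w 1 < winY A B 1 ∨ (w 1 = winY A B 1 ∧ w 0 ≤ winY A B 0) := by
  rw [winY, dif_pos h]
  exact Classical.choose_spec (exists_lexMax h)

/-- The lowest-then-leftmost site of a nonempty set lies in it and is lexicographically minimal. [folklore] -/
theorem lexMinV_spec {S : Finset (Site 2)} (h : S.Nonempty) :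
    lexMinV S ∈ S ∧ ∀ w ∈ S, lexMinV S 1 < w 1 ∨ (lexMinV S 1 = w 1 ∧ lexMinV S 0 ≤ w 0) := by
  rw [lexMinV, dif_pos h]
  exact Classical.choose_spec (exists_lexMin h)

/-- The first-contact translate is a contact translate whenever contact occurs. [folklore] -/
theorem contactT_mem {A B : Finset (Site 2)} (h : (contactDiffs A B).Nonempty) :
    contactT A B ∈ contactDiffs A B ∧ ∀ T ∈ contactDiffs A B, T ≤ contactT A B := by
  rw [contactT, dif_pos h]
  exact ⟨Finset.max'_mem _ _, fun T hT => Finset.le_max' _ _ hT⟩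

/-- Membership in the admissible offsets. [folklore] -/
theorem mem_offsets {j m : ℕ} {χ₁ χ₂ : ℕ → Site 2} {k : ℤ} :
    k ∈ offsets j m χ₁ χ₂ ↔ 3 ≤ k ∧ tipRow j χ₁ - ymax m χ₂ ≤ k ∧ k ≤ tipRow j χ₁ := by
  simp only [offsets, Finset.mem_Icc, max_le_iff, and_assoc]

/-- The entropy-side masses are nonnegative (registered infrastructure sub-goal of the programme,
carried by this definitions file). [folklore] -/
theorem Dent_nonneg : ∀ i : ℕ, 0 ≤ Dent i := by
  intro i
  refine Finset.sum_nonneg fun n _ => Finset.sum_nonneg fun n' _ => ?_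
  split_ifs
  · exact Finset.sum_nonneg fun χ₁ _ => Finset.sum_nonneg fun χ₂ _ =>
      mul_nonneg (Nat.cast_nonneg _) (pow_nonneg criticalFugacity_pos_lt_one'.1.le _)
  · exact le_rfl

/-- The spacer is `5`, `6` or `7`. [cite: Hammond2015SAPJoining, §4.1] -/
theorem spacer_mem (cτ cσ : JCase) : spacer cτ cσ = 5 ∨ spacer cτ cσ = 6 ∨ spacer cτ cσ = 7 := by
  cases cτ <;> cases cσ <;> decide

/-- The output column offset is `2` or `3`. [cite: Hammond2015SAPJoining, §4.1] -/
theorem outOff_eq (c : JCase) : outOff c = 2 ∨ outOff c = 3 := by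
  cases c <;> decide

end Summit.CriticalPhenomena.SAWScalingLimit.Theorems.CriticalBubbleBound.Join

end
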